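import Literature.MathematicalPhysics.QuantumLattice.RepKillingForm
import Literature.Algebra.Lie.SpecialUnitaryKilling
import HarnessLib

/-!
# The representation Killing form `repKilling r` IS Mathlib's Killing form of `repLieSubalgebra r`;
# sign, centre criterion, and the `SU(N)` calibration `λ(SU(N), fund) = 2N`

Topic `Literature/MathematicalPhysics/QuantumLattice`; bridge between two typings already in the tree:

* `RepKillingForm.lean` — the INSTANCE-FREE Killing form `repKilling r X Y = tr_{𝔤_r}(ad X ∘ ad Y)` on the
  submodule `𝔤_r = repLieAlgebra r ⊆ M_N(ℂ)` of a lattice representation `r : LatticeRep G` (Humphreys §5.1),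
  the Rayleigh set `casimirRatioSet r`, the adjoint-Casimir ratio `casimirRatio r = λ(G, r)` and the exactness
  predicate `HasCasimirRatio r c` (consumed by `AsymptoticFreedomScale.lean`: `b₀(G,r) = 11λ/(48π²)`, …);
* `Literature.Algebra.Lie.CompactKillingForm` / `….SpecialUnitaryKilling` — Mathlib's `killingForm ℝ 𝔤` for real
  Lie subalgebras `𝔤 ≤ 𝔲(n)` of `M_n(ℂ)` (commutator bracket = Mathlib's non-instance `LieRing.ofAssociativeRing`,
  carried by the TYPE of the tree's `repLieSubalgebra r`, so no instance attribute is needed or used here):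
  `κ(X, X) ≤ 0`, `κ(X, X) = 0 ⇔ X` central (Bröcker–tom Dieck V (5.13)), and `κ_{𝔰𝔲(n)}(X, Y) = 2n·Re Tr(XY)`
  (Sepanski, Exercise 6.19 (1)).

WHAT IS PROVED (no `sorry`, no definitions, no instance, axioms standard).
* §1 `killingForm_repLieSubalgebra` — **`κ_{repLieSubalgebra r}(X, Y) = repKilling r X Y`** (same carrier, same
  bracket `XY − YX`, same real trace); `repLieSubalgebra_le_unitaryLie` (`𝔤_r ≤ 𝔲(N)`, Hall Prop. 3.24).
* §2 **`repKilling_self_nonpos`**: `K_r(X, X) ≤ 0` for every unitary representation of a compact group;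
  **`repKilling_self_eq_zero_iff`**: `K_r(X, X) = 0 ⇔ X` commutes with all of `𝔤_r`; hence every Rayleigh quotient
  `−K(X,X)/⟨X,X⟩_HS` is `≥ 0` (`casimirRatioSet_nonneg`) and **`0 ≤ casimirRatio r`** (`casimirRatio_nonneg`, using
  `Real.sSup` conventions for the junk cases).
* §3 `hasCasimirRatio_iff_killingForm` — the exactness predicate in Mathlib's currency:
  `HasCasimirRatio r c ⇔ ∀ X ∈ 𝔤_r, κ(X, X) = c·Re Tr(X²)` (on skew-Hermitian `X`, `Re Tr(X²) = −⟨X,X⟩_HS`).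
* §4 **`SU(N)` calibration for every `N`**: `repKilling (fundamentalLatticeRep N) X Y = 2N·Re Tr(XY)`,
  `HasCasimirRatio (fundamentalLatticeRep N) (2N)`, and for `N ≥ 2` (so that `𝔰𝔲(N) ≠ 0`)
  **`casimirRatio (fundamentalLatticeRep N) = 2N`** (Humphreys §6 Exercise 7 / Sepanski Exercise 6.19 (1):
  `C₂(ad)/T_F = 2N`); `= 6` for `SU(3)`.  (`N = 2`, value `4`, is `RepKillingForm.casimirRatio_fundamentalLatticeRep_two`,
  proved there by Hall's basis; the two agree.)

Not here (Summits side, where the group hypothesis lives): `0 < casimirRatio r` for a compact SIMPLE `G`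
(`Summits/QuantumFields/YangMills/Theorems/…`, from `UVNonSUNRec.exists_lieRatio`).

**Sources (read at the cited places).** J. E. Humphreys, GTM 9 (1972) [Humphreys1972], §5.1 (`κ(x,y) = Tr(ad x ad y)`),
§6 Exercise 7 (`κ_{𝔰𝔩(n)} = 2n Tr`); B. C. Hall, GTM 222 (2015) [Hall2015], Prop. 3.24, Prop. 7.4; T. Bröcker,
T. tom Dieck, GTM 98 (1985) [BrockerTomDieck1985], V (5.13); M. R. Sepanski, GTM 235 (2007) [Sepanski2007], §6.2.2
Exercise 6.19 (1).  Nothing here concerns lattice gauge theory beyond the name of the representation.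
-/

noncomputable section

open Module Matrix

namespace Literature.MathematicalPhysics.QuantumLattice

open Literature.MathematicalPhysics.QuantumFieldTheory (LatticeRep suAlgebra mem_suAlgebra_iff)
open Literature.Algebra.Lie.CompactKillingForm (unitaryLie mem_unitaryLie_iff su mem_su_iff
  killingForm_apply_self_nonpos_of_le_unitaryLie killingForm_apply_self_eq_zero_iff_mem_center_of_le_unitaryLie)
open Literature.Algebra.Lie.SpecialUnitaryKilling (killingForm_su)

variable {G : Type*} [Group G] [TopologicalSpace G] [CompactSpace G]

/-! ### §1 The bridge -/

/-- `𝔤_r ≤ 𝔲(N)` in the currency of `CompactKillingForm.unitaryLie` (skew-Hermitian matrices): the Lie algebra of a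
unitary representation consists of skew-Hermitian matrices (tree `repLieAlgebra_le_skewAdjoint`).  Same statement as
the Summits-side `Summit.QuantumFields.YangMills.Theorems.UVNonSUNRec.repLieSubalgebra_le_unitaryLie`
(`BalabanLadderUVNonSUNRecLieRatio.lean`), which a Literature file cannot import; this is its Literature home.
[cite: Hall2015, Proposition 3.24] -/
theorem repLieSubalgebra_le_unitaryLie (r : LatticeRep G) : repLieSubalgebra r ≤ unitaryLie (Fin r.N) := by
  intro X hX
  rw [mem_unitaryLie_iff, ← Matrix.star_eq_conjTranspose]
  exact skewAdjoint.mem_iff.1 (repLieAlgebra_le_skewAdjoint r hX)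

/-- `Xᴴ = −X` for `X ∈ 𝔤_r`. [cite: Hall2015, Proposition 3.24] -/
theorem conjTranspose_coe_repLieAlgebra (r : LatticeRep G) (X : repLieAlgebra r) :
    (X : Matrix (Fin r.N) (Fin r.N) ℂ)ᴴ = -(X : Matrix (Fin r.N) (Fin r.N) ℂ) :=
  mem_unitaryLie_iff.1 (repLieSubalgebra_le_unitaryLie r X.2)

/-- On `𝔤_r` the trace form is minus the Hilbert–Schmidt form: `Re Tr(X²) = −⟨X, X⟩_HS`.
[cite: Hall2015, Exercise 7.3] -/
theorem re_trace_mul_self_eq_neg_hsForm (r : LatticeRep G) (X : repLieAlgebra r) :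
    ((X : Matrix (Fin r.N) (Fin r.N) ℂ) * (X : Matrix (Fin r.N) (Fin r.N) ℂ)).trace.re =
      -hsForm (X : Matrix (Fin r.N) (Fin r.N) ℂ) (X : Matrix (Fin r.N) (Fin r.N) ℂ) := by
  rw [hsForm_def, conjTranspose_coe_repLieAlgebra, Matrix.neg_mul, Matrix.trace_neg, Complex.neg_re, neg_neg]

/-- **THE BRIDGE.** Mathlib's Killing form of the real Lie subalgebra `repLieSubalgebra r ≤ 𝔤𝔩(N, ℂ)` (commutator
bracket) evaluated at `X, Y ∈ 𝔤_r` is the instance-free `repKilling r X Y = tr_{𝔤_r}(ad X ∘ ad Y)` of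
`RepKillingForm.lean`: same carrier (`repLieSubalgebra_toSubmodule`), same `ad X = (Y ↦ XY − YX)`, same real trace.
[cite: Humphreys1972, §5.1] -/
theorem killingForm_repLieSubalgebra (r : LatticeRep G) (X Y : repLieAlgebra r) :
    killingForm ℝ (repLieSubalgebra r) ⟨X, X.2⟩ ⟨Y, Y.2⟩ = repKilling r X Y := by
  rw [killingForm_apply_apply, repKilling_def]
  rfl

/-- The bridge read from the subalgebra side: for `X, Y : repLieSubalgebra r`,
`κ(X, Y) = repKilling r X Y`. [cite: Humphreys1972, §5.1] -/
theorem killingForm_repLieSubalgebra' (r : LatticeRep G) (X Y : repLieSubalgebra r) :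
    killingForm ℝ (repLieSubalgebra r) X Y = repKilling r ⟨X, X.2⟩ ⟨Y, Y.2⟩ :=
  killingForm_repLieSubalgebra r ⟨X, X.2⟩ ⟨Y, Y.2⟩

/-! ### §2 Sign and centre criterion (compact type) -/

/-- **`K_r(X, X) ≤ 0`** for every `X ∈ 𝔤_r`: `ad X` is skew for the Hilbert–Schmidt inner product since
`𝔤_r ≤ 𝔲(N)`, so `tr(ad X ∘ ad X) = −∑ ‖[X, eₐ]‖² ≤ 0` (tree `CompactKillingForm`, Bröcker–tom Dieck V (5.13)).
[cite: BrockerTomDieck1985, V (5.13)] -/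
theorem repKilling_self_nonpos (r : LatticeRep G) (X : repLieAlgebra r) : repKilling r X X ≤ 0 := by
  rw [← killingForm_repLieSubalgebra]
  exact killingForm_apply_self_nonpos_of_le_unitaryLie (repLieSubalgebra_le_unitaryLie r) _

/-- **`K_r(X, X) = 0 ⇔ X` is central in `𝔤_r`** (`XY = YX` for all `Y ∈ 𝔤_r`).
[cite: BrockerTomDieck1985, V (5.13)] -/
theorem repKilling_self_eq_zero_iff (r : LatticeRep G) (X : repLieAlgebra r) :
    repKilling r X X = 0 ↔ ∀ Y : repLieAlgebra r,
      (X : Matrix (Fin r.N) (Fin r.N) ℂ) * Y = Y * (X : Matrix (Fin r.N) (Fin r.N) ℂ) := by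
  rw [← killingForm_repLieSubalgebra,
    killingForm_apply_self_eq_zero_iff_mem_center_of_le_unitaryLie (repLieSubalgebra_le_unitaryLie r),
    LieAlgebra.center, LieModule.mem_maxTrivSubmodule]
  constructor
  · intro h Y
    -- `⁅Y, X⁆ = 0` in `repLieSubalgebra r`, read on matrices: `YX − XY = 0`
    have hY := congrArg Subtype.val (h ⟨Y, Y.2⟩)
    change (Y : Matrix (Fin r.N) (Fin r.N) ℂ) * X - X * Y = 0 at hY
    exact (sub_eq_zero.1 hY).symm
  · intro h Y
    apply Subtype.ext
    change (Y : Matrix (Fin r.N) (Fin r.N) ℂ) * X - X * Y = 0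
    exact sub_eq_zero.2 (h ⟨Y, Y.2⟩).symm

/-- `−K_r(X, X) ≥ 0`. [cite: BrockerTomDieck1985, V (5.13)] -/
theorem neg_repKilling_self_nonneg (r : LatticeRep G) (X : repLieAlgebra r) : 0 ≤ -repKilling r X X :=
  neg_nonneg.2 (repKilling_self_nonpos r X)

/-- Every Rayleigh quotient `−K(X,X)/⟨X,X⟩_HS` (`0 ≠ X ∈ 𝔤_r`) is `≥ 0`. [cite: BrockerTomDieck1985, V (5.13)] -/
theorem casimirRatioSet_nonneg (r : LatticeRep G) : ∀ q ∈ casimirRatioSet r, 0 ≤ q := by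
  rintro q ⟨X, hX, rfl⟩
  exact div_nonneg (neg_repKilling_self_nonneg r X) (hsForm_self_nonneg _)

/-- **`0 ≤ λ(G, r)`** for every unitary representation of a compact group (also in the junk cases of `Real.sSup`:
empty or unbounded quotient set gives `0`). [cite: BrockerTomDieck1985, V (5.13)] -/
theorem casimirRatio_nonneg (r : LatticeRep G) : 0 ≤ casimirRatio r :=
  Real.sSup_nonneg (casimirRatioSet_nonneg r)

/-! ### §3 The exactness predicate in Mathlib's currency -/

/-- `HasCasimirRatio r c` (i.e. `K(X,X) = −c·⟨X,X⟩_HS` on `𝔤_r`) **iff** `κ_{repLieSubalgebra r}(X, X) = c·Re Tr(X²)`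
for all `X` — the form in which Summits-side records state the Killing∕trace ratio. [cite: Humphreys1972, §6 Exercise 6] -/
theorem hasCasimirRatio_iff_killingForm (r : LatticeRep G) (c : ℝ) :
    HasCasimirRatio r c ↔ ∀ X : repLieSubalgebra r, killingForm ℝ (repLieSubalgebra r) X X =
      c * ((X : Matrix (Fin r.N) (Fin r.N) ℂ) * (X : Matrix (Fin r.N) (Fin r.N) ℂ)).trace.re := by
  constructor
  · intro h X
    rw [killingForm_repLieSubalgebra', h ⟨X, X.2⟩, re_trace_mul_self_eq_neg_hsForm r ⟨X, X.2⟩]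
    ring
  · intro h X
    rw [← killingForm_repLieSubalgebra, h ⟨X, X.2⟩, re_trace_mul_self_eq_neg_hsForm r X]
    ring

/-! ### §4 Calibration: `SU(N)`, fundamental representation — `λ = 2N` -/

/-- **`K(X, Y) = 2N·Re Tr(XY)` on `𝔤_{SU(N), fund} = 𝔰𝔲(N)`** for every `N`: the Killing form of `𝔰𝔲(N)` (tree
`SpecialUnitaryKilling.killingForm_su`, via `𝔰𝔲(N)ᶜ = 𝔰𝔩(N, ℂ)` and Humphreys' `κ_{𝔰𝔩(n)} = 2n Tr`) transported along
the identity isomorphism `repLieSubalgebra (fundamentalLatticeRep N) = 𝔰𝔲(N)` (same carrier, tree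
`repLieAlgebra_fundamental`; Mathlib `LieAlgebra.killingForm_of_equiv_apply`).  Matrix coercions are written at the
carrier type `Matrix (Fin (fundamentalLatticeRep N).N) (Fin (fundamentalLatticeRep N).N) ℂ` (`= Matrix (Fin N) (Fin N) ℂ`
by `fundamentalLatticeRep_N`, not reducibly). [cite: Sepanski2007, §6.2.2 Exercise 6.19 (1); Humphreys1972, §6 Exercise 7] -/
theorem repKilling_fundamentalLatticeRep (N : ℕ) (X Y : repLieAlgebra (fundamentalLatticeRep N)) :
    repKilling (fundamentalLatticeRep N) X Y =
      2 * N * ((X : Matrix (Fin (fundamentalLatticeRep N).N) (Fin (fundamentalLatticeRep N).N) ℂ) *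
        (Y : Matrix (Fin (fundamentalLatticeRep N).N) (Fin (fundamentalLatticeRep N).N) ℂ)).trace.re := by
  -- same carrier: `repLieSubalgebra (fundamentalLatticeRep N) = 𝔰𝔲(N)` (Hall, Prop. 3.24; tree `repLieAlgebra_fundamental`)
  have hsub : repLieSubalgebra (fundamentalLatticeRep N) = su (Fin N) :=
    SetLike.ext fun Z =>
      ((mem_repLieSubalgebra_iff _).trans (SetLike.ext_iff.1 (repLieAlgebra_fundamental N) Z)).trans
        ((mem_suAlgebra_iff Z).trans mem_su_iff.symm)
  -- the identity isomorphism, with the commutator Lie ring of `M_N(ℂ)` supplied explicitly (no instance attribute)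
  let e := @LieEquiv.ofEq ℝ (Matrix (Fin N) (Fin N) ℂ) _ LieRing.ofAssociativeRing _
    (repLieSubalgebra (fundamentalLatticeRep N)) (su (Fin N)) (congrArg SetLike.coe hsub)
  rw [← killingForm_repLieSubalgebra]
  have h1 := LieAlgebra.killingForm_of_equiv_apply e ⟨X.1, X.2⟩ ⟨Y.1, Y.2⟩
  have h2 := killingForm_su (e ⟨X.1, X.2⟩) (e ⟨Y.1, Y.2⟩)
  rw [Fintype.card_fin] at h2
  exact h1.symm.trans h2

/-- **`HasCasimirRatio (fundamentalLatticeRep N) (2N)`** for every `N`: on `𝔰𝔲(N)` the Killing form is `−2N` times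
the Hilbert–Schmidt form `Re Tr(XᴴY)` (`K(X,X) = 2N Re Tr X² = −2N ⟨X,X⟩_HS`). For `N ≤ 1` both sides vanish
(`𝔰𝔲(1) = 𝔰𝔲(0) = 0`). [cite: Humphreys1972, §6 Exercise 7] -/
theorem hasCasimirRatio_fundamentalLatticeRep (N : ℕ) : HasCasimirRatio (fundamentalLatticeRep N) (2 * N) := by
  intro X
  rw [repKilling_fundamentalLatticeRep, re_trace_mul_self_eq_neg_hsForm]
  ring

/-- For `N ≥ 2`, `𝔰𝔲(N) ≠ 0`: the Lie algebra of the fundamental representation of `SU(N)` has a non-zero element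
(its real dimension is `N² − 1 ≥ 3`, tree `finrank_repLieAlgebra_fundamental`). [cite: BrockerTomDieck1985, I (2.18)] -/
theorem exists_coe_ne_zero_fundamentalLatticeRep {N : ℕ} (hN : 2 ≤ N) :
    ∃ X : repLieAlgebra (fundamentalLatticeRep N),
      (X : Matrix (Fin (fundamentalLatticeRep N).N) (Fin (fundamentalLatticeRep N).N) ℂ) ≠ 0 := by
  have h4 : 4 ≤ N ^ 2 := by
    calc (4 : ℕ) = 2 ^ 2 := by norm_num
      _ ≤ N ^ 2 := Nat.pow_le_pow_left hN 2
  have hpos : 0 < finrank ℝ (repLieAlgebra (fundamentalLatticeRep N)) := by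
    rw [finrank_repLieAlgebra_fundamental]
    omega
  obtain ⟨X, hX⟩ := finrank_pos_iff_exists_ne_zero.1 hpos
  exact ⟨X, fun h => hX (Subtype.ext h)⟩

/-- **`λ(SU(N), fund) = 2N` for `N ≥ 2`**: the adjoint-Casimir ratio of the fundamental representation of `SU(N)`
in the trace normalisation `Re Tr(X*Y)` — Humphreys' `κ = 2n Tr` on `𝔰𝔩(n)` restricted to its compact real form
(`C₂(G)/T_F = N/(1/2)`); the `N`-general form of `casimirRatio_fundamentalLatticeRep_two`.
[cite: Humphreys1972, §6 Exercise 7; Sepanski2007, §6.2.2 Exercise 6.19 (1)] -/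
theorem casimirRatio_fundamentalLatticeRep {N : ℕ} (hN : 2 ≤ N) :
    casimirRatio (fundamentalLatticeRep N) = 2 * N :=
  casimirRatio_eq_of_hasCasimirRatio (hasCasimirRatio_fundamentalLatticeRep N)
    (exists_coe_ne_zero_fundamentalLatticeRep hN)

/-- `λ(SU(3), fund) = 6` — the colour group of QCD (`C_A/T_F = 3/(1/2)`). [cite: Sepanski2007, §6.2.2 Exercise 6.19 (1)] -/
theorem casimirRatio_fundamentalLatticeRep_three : casimirRatio (fundamentalLatticeRep 3) = 6 := by
  rw [casimirRatio_fundamentalLatticeRep (by norm_num : 2 ≤ 3)]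
  norm_num

/-- For `N ≤ 1` the Lie algebra `𝔰𝔲(N)` is zero, the quotient set is empty and `λ` takes the junk value `0`
(sharpness of the guard `2 ≤ N`). [cite: BrockerTomDieck1985, I (2.18)] -/
theorem casimirRatio_fundamentalLatticeRep_of_le_one {N : ℕ} (hN : N ≤ 1) :
    casimirRatio (fundamentalLatticeRep N) = 0 := by
  have h0 : finrank ℝ (repLieAlgebra (fundamentalLatticeRep N)) = 0 := by
    rw [finrank_repLieAlgebra_fundamental]
    interval_cases N <;> norm_num
  haveI : Subsingleton (repLieAlgebra (fundamentalLatticeRep N)) := finrank_zero_iff.1 h0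
  have hempty : casimirRatioSet (fundamentalLatticeRep N) = ∅ := by
    refine Set.eq_empty_iff_forall_notMem.2 ?_
    rintro q ⟨X, hX, -⟩
    exact hX (by rw [Subsingleton.elim X 0]; rfl)
  rw [casimirRatio, hempty, Real.sSup_empty]

end Literature.MathematicalPhysics.QuantumLattice

end
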